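import Summits.AtomisticToContinuum.Crystallization.Theorems.PalmUnimodularRigidityShellsToBarlowChartDefs

/-!
# Local charts for line `develop-the-model-growth-descent`
(crux `ShellsToBarlowChart`, stmt-AtomisticToContinuum-9227, stub `stub_localCharts`)

## Summary
* stub `stub_localCharts : ∀ S, GoodShells S → ∀ x ∈ S, LocalChart S x` — the local front end of
  the line ("window graph = shell graph, links exact").
* Proof: unpack `GoodShellAt (9/10) 1 S x`; the matching bijection `e₀ : T ≃ A(a•P)` labels the
  shell points by pattern points; norms `a ± a/100` put every shell point in the bond window and
  the window radius `28/25 ≤ 5a/4` puts every bonded neighbour in the shell; links are exact by the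
  pattern distance dichotomy `dist v w = 1 ∨ √2 ≤ dist v w` (integer arithmetic on `fccInt`,
  `hcpInt`: `sqNormInt_sub_fccInt_eq_or_le`, `sqNormInt_sub_hcpInt_eq_or_le` of
  `FejesTothKissingTwelve.lean`) and two triangle inequalities
  (`|dist (e v) (e w) − a·dist v w| ≤ a/50`).

## Contents
* `dist_eq_one_or_sqrt_two_le_of_mem_scaledPattern`, `…_fccKissingPattern`, `…_hcpKissingPattern`:
  the pattern pair-distance dichotomy.
* `localChart_of_shellCloseTo`: the chart from one matched shell (uniform in the pattern).
* `stub_localCharts`: the registered stub.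
-/

noncomputable section

namespace Summit.AtomisticToContinuum.Crystallization.Theorems.PalmUnimodularRigidityShellsToBarlowChart

open Literature.Geometry.DiscreteGeometry Literature.MathematicalPhysics.StatisticalMechanics
open Summit.AtomisticToContinuum.Crystallization.Theorems.ShellsToBarlowChartNegative

/-- Euclidean `3`-space. -/
local notation "E3" => EuclideanSpace ℝ (Fin 3)

/-! ## The pattern pair-distance dichotomy -/

/-- In a scaled integer pattern `{v/√N : v ∈ P}` whose difference vectors have squared norm `N` or
`≥ 2N`, two distinct points are at distance exactly `1` or at least `√2`. [folklore] -/
theorem dist_eq_one_or_sqrt_two_le_of_mem_scaledPattern {P : Finset (Fin 3 → ℤ)} {N : ℕ}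
    (hN : N ≠ 0)
    (hP : ∀ v ∈ P, ∀ w ∈ P, v ≠ w → sqNormInt (v - w) = N ∨ 2 * (N : ℤ) ≤ sqNormInt (v - w))
    {p q : E3} (hp : p ∈ scaledPattern P N) (hq : q ∈ scaledPattern P N) (hpq : p ≠ q) :
    dist p q = 1 ∨ Real.sqrt 2 ≤ dist p q := by
  obtain ⟨v, hv, rfl⟩ := Finset.mem_image.1 hp
  obtain ⟨w, hw, rfl⟩ := Finset.mem_image.1 hq
  have hvw : v ≠ w := fun h => hpq (by rw [h])
  have hpos : (0 : ℝ) < Real.sqrt N := by positivity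
  have hd : dist ((Real.sqrt N)⁻¹ • intVec v : E3) ((Real.sqrt N)⁻¹ • intVec w) =
      (Real.sqrt N)⁻¹ * Real.sqrt (sqNormInt (v - w) : ℝ) := by
    rw [dist_eq_norm, ← smul_sub, intVec_sub, norm_smul, norm_inv, Real.norm_of_nonneg hpos.le,
      norm_intVec]
  rw [hd]
  rcases hP v hv w hw hvw with h | h
  · left
    rw [h, Int.cast_natCast, inv_mul_cancel₀ hpos.ne']
  · right
    rw [le_inv_mul_iff₀ hpos, ← Real.sqrt_mul (Nat.cast_nonneg N)]
    refine Real.sqrt_le_sqrt ?_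
    have h' : ((2 * (N : ℤ) : ℤ) : ℝ) ≤ ((sqNormInt (v - w) : ℤ) : ℝ) := by exact_mod_cast h
    push_cast at h'
    linarith

/-- In the FCC kissing pattern two distinct points are at distance `1` (touching) or `≥ √2`.
[cite: ConwaySloane1999, Ch. 4 §6.3] -/
theorem dist_eq_one_or_sqrt_two_le_of_mem_fccKissingPattern {p q : E3}
    (hp : p ∈ fccKissingPattern) (hq : q ∈ fccKissingPattern) (hpq : p ≠ q) :
    dist p q = 1 ∨ Real.sqrt 2 ≤ dist p q :=
  dist_eq_one_or_sqrt_two_le_of_mem_scaledPattern two_ne_zero sqNormInt_sub_fccInt_eq_or_le hp hq hpq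

/-- In the HCP kissing pattern two distinct points are at distance `1` (touching) or `≥ √2`.
[cite: HalesDSP2012, §1.3] -/
theorem dist_eq_one_or_sqrt_two_le_of_mem_hcpKissingPattern {p q : E3}
    (hp : p ∈ hcpKissingPattern) (hq : q ∈ hcpKissingPattern) (hpq : p ≠ q) :
    dist p q = 1 ∨ Real.sqrt 2 ≤ dist p q :=
  dist_eq_one_or_sqrt_two_le_of_mem_scaledPattern (by norm_num) sqNormInt_sub_hcpInt_eq_or_le hp hq
    hpq

/-! ## The chart from one matched shell -/

/-- **Local chart from a good shell.**  If the recentred `5a/4`-shell `T` of `x ∈ S`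
(`a ∈ [9/10, 1]`) is `a/100`-matched to `A(a•P)` for a pattern `P` of unit vectors with the
distance dichotomy `dist v w = 1 ∨ √2 ≤ dist v w`, then the matching labels the bonded neighbours of
`x` bijectively by `P`, each label `v` sitting within `a/100` of `x + a•A v`, and two neighbours are
bonded iff their labels touch: shell points have norm `a ± a/100 ∈ (0, 28/25]`, bonded neighbours
lie within `28/25 ≤ 5a/4`, and neighbour distances are `a·dist v w ± a/50`, which is `≤ 1.02` for
touching labels and `≥ (7/5 − 1/50)·(9/10) > 28/25` otherwise. [folklore] -/
theorem localChart_of_shellCloseTo {S : Set E3} {x : E3} {a : ℝ} (ha9 : 9 / 10 ≤ a) (ha1 : a ≤ 1)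
    {P : Finset E3} (hP1 : ∀ v ∈ P, ‖v‖ = 1)
    (hP2 : ∀ v ∈ P, ∀ w ∈ P, v ≠ w → dist v w = 1 ∨ Real.sqrt 2 ≤ dist v w)
    {T : Finset E3}
    (hT : (↑T : Set E3) =
      (fun y : E3 => y - x) '' {y : E3 | y ∈ S ∧ y ≠ x ∧ dist y x ≤ 5 / 4 * a})
    (hclose : ShellCloseTo (a / 100) T (P.image fun v : E3 => a • v)) :
    ∃ A : E3 →ₗᵢ[ℝ] E3, ∃ e : E3 → E3, Set.BijOn e (↑P : Set E3) (bondNbrs S x) ∧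
      (∀ v ∈ P, dist (e v) (x + a • A v) ≤ a / 100) ∧
      (∀ v ∈ P, ∀ w ∈ P, (dist v w = 1 ↔ IsBond (e v) (e w))) := by
  classical
  obtain ⟨A, e₀, he₀⟩ := hclose
  have ha0 : 0 < a := by linarith
  have hmem : ∀ v ∈ P, A (a • v) ∈ (P.image fun v : E3 => a • v).image A := fun v hv =>
    Finset.mem_image_of_mem _ (Finset.mem_image_of_mem _ hv)
  -- the shell point labelled by `v ∈ P` (junk `0` off `P`), recentred at `x`
  obtain ⟨z, hz⟩ : ∃ z : E3 → E3, ∀ v (hv : v ∈ P),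
      z v = ((e₀.symm ⟨A (a • v), hmem v hv⟩ : ↥T) : E3) :=
    ⟨fun v => if hv : v ∈ P then ((e₀.symm ⟨A (a • v), hmem v hv⟩ : ↥T) : E3) else 0,
      fun v hv => dif_pos hv⟩
  -- (1) it is a shell point of `x`
  have hzS : ∀ v ∈ P, x + z v ∈ S := by
    intro v hv
    have h : z v ∈ (↑T : Set E3) := by
      rw [hz v hv]
      exact Finset.mem_coe.2 (Finset.coe_mem _)
    rw [hT] at h
    obtain ⟨y, ⟨hyS, -, -⟩, hy⟩ := h
    have hy' : y - x = z v := hy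
    rw [← hy', add_sub_cancel]
    exact hyS
  -- (2) it is `a/100`-close to the rotated scaled pattern point
  have hzd : ∀ v (hv : v ∈ P), dist (z v) (A (a • v)) ≤ a / 100 := by
    intro v hv
    have h := he₀ (e₀.symm ⟨A (a • v), hmem v hv⟩)
    rw [Equiv.apply_symm_apply] at h
    rw [hz v hv]
    exact h
  -- (3) hence its norm is within `a/100` of `a`
  have hzn : ∀ v ∈ P, |‖z v‖ - a| ≤ a / 100 := by
    intro v hv
    have h1 : |‖z v‖ - ‖A (a • v)‖| ≤ ‖z v - A (a • v)‖ := abs_norm_sub_norm_le _ _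
    rw [LinearIsometry.norm_map, norm_smul, Real.norm_of_nonneg ha0.le, hP1 v hv, mul_one,
      ← dist_eq_norm] at h1
    exact h1.trans (hzd v hv)
  -- (4) and pair distances are within `a/50` of the scaled pattern distances
  have hzz : ∀ v ∈ P, ∀ w ∈ P, |dist (z v) (z w) - a * dist v w| ≤ a / 50 := by
    intro v hv w hw
    have hA : dist (A (a • v)) (A (a • w)) = a * dist v w := by
      rw [LinearIsometry.dist_map, dist_smul₀, Real.norm_of_nonneg ha0.le]
    have h1 := hzd v hv
    have h2 := hzd w hw
    rw [abs_sub_le_iff]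
    constructor
    · linarith [dist_triangle4 (z v) (A (a • v)) (A (a • w)) (z w),
        dist_comm (z w) (A (a • w))]
    · linarith [dist_triangle4 (A (a • v)) (z v) (z w) (A (a • w)),
        dist_comm (z v) (A (a • v))]
  -- the chart `e v := x + z v`
  refine ⟨A, fun v => x + z v, ⟨?_, ?_, ?_⟩, ?_, ?_⟩
  · -- into the bonded neighbours: norm `a ± a/100 ∈ (0, 28/25]`
    intro v hv
    have hv' : v ∈ P := Finset.mem_coe.1 hv
    have hn := hzn v hv'
    rw [abs_le] at hn
    show x + z v ∈ S ∧ 0 < dist x (x + z v) ∧ dist x (x + z v) ≤ 28 / 25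
    rw [dist_self_add_right]
    exact ⟨hzS v hv', by linarith, by linarith⟩
  · -- injective on `P`: `e₀.symm`, `A` and `a • ·` are injective
    intro v hv w hw hvw
    have hv' : v ∈ P := Finset.mem_coe.1 hv
    have hw' : w ∈ P := Finset.mem_coe.1 hw
    have h1 : z v = z w := add_left_cancel hvw
    rw [hz v hv', hz w hw'] at h1
    have h2 := e₀.symm.injective (Subtype.ext h1)
    have h3 : A (a • v) = A (a • w) := congrArg Subtype.val h2
    exact smul_right_injective E3 ha0.ne' (A.injective h3)
  · -- onto the bonded neighbours: `28/25 ≤ 5a/4`, so a bonded neighbour is a shell point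
    intro y hy
    obtain ⟨hyS, hpos, hle⟩ := hy
    have hyx : y ≠ x := by
      intro h
      rw [h, dist_self] at hpos
      exact lt_irrefl _ hpos
    have hyT : y - x ∈ (↑T : Set E3) := by
      rw [hT]
      refine ⟨y, ⟨hyS, hyx, ?_⟩, rfl⟩
      rw [dist_comm]
      linarith
    have hyT' : y - x ∈ T := Finset.mem_coe.1 hyT
    obtain ⟨u, hu, hut⟩ := Finset.mem_image.1 (e₀ ⟨y - x, hyT'⟩).2
    obtain ⟨v, hv, rfl⟩ := Finset.mem_image.1 hu
    refine ⟨v, Finset.mem_coe.2 hv, ?_⟩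
    have h4 : (⟨A (a • v), hmem v hv⟩ : ↥((P.image fun v : E3 => a • v).image A)) =
        e₀ ⟨y - x, hyT'⟩ := Subtype.ext hut
    show x + z v = y
    rw [hz v hv, h4, Equiv.symm_apply_apply]
    exact add_sub_cancel x y
  · -- closeness
    intro v hv
    simpa only [dist_add_left, map_smul] using hzd v hv
  · -- links are exact
    intro v hv w hw
    have hb := hzz v hv w hw
    rw [abs_le] at hb
    show dist v w = 1 ↔ 0 < dist (x + z v) (x + z w) ∧ dist (x + z v) (x + z w) ≤ 28 / 25
    rw [dist_add_left]
    by_cases hvw : v = w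
    · subst hvw
      simp
    · rcases hP2 v hv w hw hvw with h | h
      · rw [h, mul_one] at hb
        exact ⟨fun _ => ⟨by linarith, by linarith⟩, fun _ => h⟩
      · have h75 : (7 / 5 : ℝ) < Real.sqrt 2 := by
          rw [show (7 / 5 : ℝ) = Real.sqrt ((7 / 5) ^ 2) by rw [Real.sqrt_sq]; norm_num]
          exact Real.sqrt_lt_sqrt (by norm_num) (by norm_num)
        refine ⟨fun h1 => ?_, fun hb' => ?_⟩
        · rw [h1] at h
          linarith
        · exfalso
          obtain ⟨-, hle⟩ := hb'
          have : a * (7 / 5) ≤ a * dist v w :=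
            mul_le_mul_of_nonneg_left (h75.le.trans h) ha0.le
          linarith

/-! ## The stub -/

/-- **Local charts (stub `stub_localCharts` of line `develop-the-model-growth-descent`).**  Every
point `x` of an every-point-good set `S` has a local chart: its bonded neighbours are an
`a/100`-perturbed rotated copy of the `a`-scaled FCC or HCP kissing pattern, labelled bijectively,
and two neighbours are bonded iff their labels touch in the pattern ("window graph = shell graph,
links exact"). [folklore] -/
theorem stub_localCharts :
    ∀ S : Set E3, GoodShells S → ∀ x ∈ S, LocalChart S x := by
  intro S hG x hx
  obtain ⟨a, ha9, ha1, T, hT, hclose⟩ := hG x hx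
  rcases hclose with h | h
  · obtain ⟨A, e, hbij, hd, hl⟩ := localChart_of_shellCloseTo ha9 ha1
      (fun v hv => norm_eq_one_of_mem_fccKissingPattern hv)
      (fun v hv w hw hvw => dist_eq_one_or_sqrt_two_le_of_mem_fccKissingPattern hv hw hvw) hT h
    exact ⟨a, ha9, ha1, fccKissingPattern, Or.inl rfl, A, e, hbij, hd, hl⟩
  · obtain ⟨A, e, hbij, hd, hl⟩ := localChart_of_shellCloseTo ha9 ha1
      (fun v hv => norm_eq_one_of_mem_hcpKissingPattern hv)
      (fun v hv w hw hvw => dist_eq_one_or_sqrt_two_le_of_mem_hcpKissingPattern hv hw hvw) hT h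
    exact ⟨a, ha9, ha1, hcpKissingPattern, Or.inr rfl, A, e, hbij, hd, hl⟩

end Summit.AtomisticToContinuum.Crystallization.Theorems.PalmUnimodularRigidityShellsToBarlowChart

end
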